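/-
Copyright (c) 2026 the pub-hodgecm-mathlib formalisation cell (harness21).  Prover seat hodgecm-mathlib-K2Liu-p12 (g0): Track B «K2-LIT»,
#184♮ = hLiu418 = stmt-HodgeConjecture-24832; Road Φ of socket #41, organ Φ5 «bad finite places» (LEAD F0P6-plan (g12) CAP-1 deal, REQUESTS l.72710), file F2.
-/
import Literature.Analysis.Complex.HolomorphicParametricIntegral     -- ★ `Literature.Analysis.Complex.differentiableOn_integral_of_dominated`
import Mathlib.MeasureTheory.Integral.Bochner.Set
import HarnessLib

/-!
# Crux `HLiu418`, Road Φ of socket #41, organ Φ5 — FILE F2: SHELL STABILIZATION (eventually vanishing shells ⇒ one compact ball; entire in the parameter)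

Cell `hodgecm-mathlib`, crux item hLiu418 = `stmt-HodgeConjecture-24832`, route of record `HCCMUnconditional`; squad K2 ∕ K2Liu, road `K2_Liu`,
socket #41 `sig_K2LiuSiegelEisensteinContinuation`, Road Φ (ruling «M-155l»), organ Φ5 (census `K2/K2Liu-p12/g0/CENSUS-PHI5-BadPlaceWhittaker.K2Liu-p12-g0.md`
§3, file F2; file F1 = ★ `K2LiuShellVanishingByAveraging`).  THEOREMS ONLY (no `def`, no `instance`, no `notation`, no named-fact hypothesis, no `sorry`);
lane `--supports stmt-HodgeConjecture-24832` (count-neutral helper; closes no socket by itself).  Carrier-free: `(V, μ)` is any measure space.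

THE MATHEMATICS (Karel's lemma, second half).  Let `B₀ ⊆ B₁ ⊆ ⋯` be measurable sets (the balls `n(ϖ^{−k}Λ)` of `N_Δ(F_v)`) and `g` a function whose
integrals over the shells `B_{k+1} ∖ B_k` vanish for `k ≥ k₀` (F1).  Then
* §1 `setIntegral_eq_setIntegral_of_shells`: `∫_{B_k} g = ∫_{B_{k₀}} g` for every `k ≥ k₀` (telescoping, Mathlib `setIntegral_sdiff`);
  `integral_eq_setIntegral_of_shells`: if `g ∈ L¹(V)` and `⋃_k B_k = V` then `∫_V g = ∫_{B_{k₀}} g` (Mathlib `tendsto_setIntegral_of_monotone` + an eventually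
  constant sequence) — so the absolutely convergent Whittaker integral (large `Re s`) IS the ball integral, and the ball integral is the definition-free
  continuation for all `s`;
* §2 `differentiable_setIntegral_of_locally_bounded`: for a family `K s x` entire in `s` for each `x`, measurable in `x`, and locally (in `s`) uniformly
  bounded on a set `S` of finite measure, `s ↦ ∫_S K s x dμ` is ENTIRE (★ dominated holomorphic parametric integrals,
  `Literature.Analysis.Complex.differentiableOn_integral_of_dominated`, constant majorant) — the `K_v`-flat Siegel family `f_s(w_Δ n(X) h)·ψ̄_β(X)` on the
  ball `B_{k₀}` is such a family; `norm_setIntegral_le_of_norm_le_mul_unit`: the bound `‖∫_S φ·χ‖ ≤ C·μ(S)` for `‖φ‖ ≤ C` on `S` and a unitary weight `‖χ‖ ≤ 1`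
  (the polynomial-in-`β` bound of Φ5 is this with `S = B_{k₀(β)}`, `μ(B_{k₀(β)}) = q_v^{n²k₀(β)}·μ(B₀)`).

## References
* [Casselman1980] W. Casselman, *The unramified principal series of p-adic groups I*, Compositio Math. 40 (1980), §3 (the Jacquet integral over `N` as a
  limit of integrals over an exhaustion by compact open subgroups, eventually constant against a non-degenerate character).
* [KudlaRallis1994] S. Kudla, S. Rallis, Ann. of Math. 140 (1994), §2 (local Whittaker functionals of degenerate principal series are entire).
* [Shimura1997] G. Shimura, *Euler products and Eisenstein series*, CBMS 93 (1997), §18 (local coefficients at bad places).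
-/

set_option autoImplicit false
-- the mandated namespace repeats the single-problem summit's segment (`HodgeConjecture.HodgeConjecture`)
set_option linter.dupNamespace false

noncomputable section

open scoped ENNReal Topology
open MeasureTheory Set Filter Metric

namespace Summit.HodgeConjecture.HodgeConjecture.Cruxes.HLiu418.K2LiuShellStabilization

variable {V : Type*} [MeasurableSpace V]

/-! ## §1 Eventually vanishing shells -/

/-- **Telescoping over shells**: if `B` is a monotone sequence of measurable sets, `g` is integrable on each `B k`, and the integrals of `g` over the shells
`B (k+1) ∖ B k` vanish for `k ≥ k₀`, then `∫_{B k} g = ∫_{B k₀} g` for all `k ≥ k₀`. [cite: Casselman1980, §3] -/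
theorem setIntegral_eq_setIntegral_of_shells (μ : Measure V) {B : ℕ → Set V} (hBm : ∀ k, MeasurableSet (B k)) (hmono : Monotone B)
    {g : V → ℂ} (hint : ∀ k, IntegrableOn g (B k) μ) {k₀ : ℕ} (hshell : ∀ k, k₀ ≤ k → ∫ x in B (k + 1) \ B k, g x ∂μ = 0)
    {k : ℕ} (hk : k₀ ≤ k) : ∫ x in B k, g x ∂μ = ∫ x in B k₀, g x ∂μ := by
  induction k, hk using Nat.le_induction with
  | base => rfl
  | succ k hk ih =>
    have h := setIntegral_sdiff (hBm k) (hint (k + 1)) (hmono k.le_succ)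
    rw [hshell k hk] at h
    rw [← ih]
    exact (sub_eq_zero.1 h.symm)

/-- **The whole integral is one ball integral**: if moreover `g ∈ L¹(V, μ)` and the `B k` exhaust `V`, then `∫_V g = ∫_{B k₀} g` — the absolutely convergent
Whittaker integral equals its truncation at the stabilization radius. [cite: Casselman1980, §3] [cite: KudlaRallis1994, §2] -/
theorem integral_eq_setIntegral_of_shells (μ : Measure V) {B : ℕ → Set V} (hBm : ∀ k, MeasurableSet (B k)) (hmono : Monotone B)
    (hcover : (⋃ k, B k) = univ) {g : V → ℂ} (hint : Integrable g μ) {k₀ : ℕ}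
    (hshell : ∀ k, k₀ ≤ k → ∫ x in B (k + 1) \ B k, g x ∂μ = 0) : ∫ x, g x ∂μ = ∫ x in B k₀, g x ∂μ := by
  have hlim : Tendsto (fun k => ∫ x in B k, g x ∂μ) atTop (𝓝 (∫ x in ⋃ k, B k, g x ∂μ)) :=
    tendsto_setIntegral_of_monotone hBm hmono hint.integrableOn
  rw [hcover, Measure.restrict_univ] at hlim
  have hconst : Tendsto (fun k => ∫ x in B k, g x ∂μ) atTop (𝓝 (∫ x in B k₀, g x ∂μ)) := by
    refine tendsto_const_nhds.congr' ?_
    filter_upwards [eventually_ge_atTop k₀] with k hk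
    exact (setIntegral_eq_setIntegral_of_shells μ hBm hmono (fun k => hint.integrableOn) hshell hk).symm
  exact tendsto_nhds_unique hlim hconst

/-- shells in `ℤ`-indexed form reduce to the `ℕ`-indexed one by re-basing at any `k₁ ≤ k₀`: if the shell integrals of a monotone family `B : ℤ → Set V` vanish for
`k ≥ k₀`, then `∫_{B k} g = ∫_{B k₀} g` for `k ≥ k₀`. [cite: Casselman1980, §3] -/
theorem setIntegral_eq_setIntegral_of_shells_int (μ : Measure V) {B : ℤ → Set V} (hBm : ∀ k, MeasurableSet (B k)) (hmono : Monotone B)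
    {g : V → ℂ} (hint : ∀ k, IntegrableOn g (B k) μ) {k₀ : ℤ} (hshell : ∀ k, k₀ ≤ k → ∫ x in B (k + 1) \ B k, g x ∂μ = 0)
    {k : ℤ} (hk : k₀ ≤ k) : ∫ x in B k, g x ∂μ = ∫ x in B k₀, g x ∂μ := by
  -- re-index `B' j := B (k₀ + j)` over `ℕ`
  obtain ⟨j, rfl⟩ := Int.le.dest hk
  have h := setIntegral_eq_setIntegral_of_shells μ (B := fun j : ℕ => B (k₀ + j)) (fun j => hBm _)
    (fun a b hab => hmono (by omega)) (fun j => hint _) (k₀ := 0)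
    (fun j _ => by
      have := hshell (k₀ + j) (by omega)
      rwa [show k₀ + ((j + 1 : ℕ) : ℤ) = k₀ + j + 1 by push_cast; ring]) (Nat.zero_le j)
  simpa using h

/-! ## §2 The ball integral is entire in the parameter; the bound -/

/-- **Entire dependence on the parameter** (dominated holomorphic parametric integral with a constant majorant): on a set `S` of finite measure, if
`s ↦ K s x` is entire for every `x`, `K s` is measurable on `S` for every `s`, and `K` is locally-in-`s` uniformly bounded on `S`, then `s ↦ ∫_S K s x dμ` is entire.
For the `K_v`-flat Siegel family, `K s X = f_s(w_Δ n(X) h)·ψ̄_β(X)` on the stabilization ball. [cite: KudlaRallis1994, §2] [cite: Shimura1997, §18] -/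
theorem differentiable_setIntegral_of_locally_bounded (μ : Measure V) {S : Set V} (hS : MeasurableSet S) (hSμ : μ S ≠ ∞) {K : ℂ → V → ℂ}
    (hdiff : ∀ x, Differentiable ℂ fun s => K s x) (hmeas : ∀ s, AEStronglyMeasurable (K s) (μ.restrict S))
    (hbd : ∀ s₀ : ℂ, ∃ ε > 0, ∃ C : ℝ, ∀ s ∈ ball s₀ ε, ∀ x ∈ S, ‖K s x‖ ≤ C) :
    Differentiable ℂ fun s => ∫ x in S, K s x ∂μ := by
  haveI : IsFiniteMeasure (μ.restrict S) := isFiniteMeasure_restrict.2 hSμ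
  rw [← differentiableOn_univ]
  refine Literature.Analysis.Complex.differentiableOn_integral_of_dominated (μ := μ.restrict S) (F := K) (U := univ)
    (fun s _ => hmeas s) (ae_of_all _ fun x => (hdiff x).differentiableOn) fun s₀ _ => ?_
  obtain ⟨ε, hε, C, hC⟩ := hbd s₀
  refine ⟨ε, hε, subset_univ _, fun _ => C, integrable_const C, ?_⟩
  filter_upwards [ae_restrict_mem hS] with x hx
  exact fun s hs => hC s hs x hx

/-- **The bound**: `‖∫_S φ·χ dμ‖ ≤ C·μ(S)` when `‖φ‖ ≤ C` on `S` and the weight is unitary-bounded (`‖χ‖ ≤ 1`; in Φ5 `χ = ψ̄_β`).  With `S` the stabilization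
ball `n(ϖ^{−k₀(β)}Λ)`, `μ(S) = q_v^{n²k₀(β)}·μ(n(Λ))` is polynomial in `‖β⁻¹‖_v`. [cite: Shimura1997, §18] -/
theorem norm_setIntegral_le_of_norm_le_mul_unit (μ : Measure V) {S : Set V} (hSμ : μ S ≠ ∞) {φ χ : V → ℂ} {C : ℝ}
    (hφ : ∀ x ∈ S, ‖φ x‖ ≤ C) (hχ : ∀ x ∈ S, ‖χ x‖ ≤ 1) : ‖∫ x in S, φ x * χ x ∂μ‖ ≤ C * μ.real S := by
  refine norm_setIntegral_le_of_norm_le_const (lt_top_iff_ne_top.2 hSμ) fun x hx => ?_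
  rw [norm_mul]
  have hC : 0 ≤ C := (norm_nonneg _).trans (hφ x hx)
  calc ‖φ x‖ * ‖χ x‖ ≤ C * 1 := mul_le_mul (hφ x hx) (hχ x hx) (norm_nonneg _) hC
    _ = C := mul_one C

end Summit.HodgeConjecture.HodgeConjecture.Cruxes.HLiu418.K2LiuShellStabilization

end
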